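import Summits.QuantumFields.BalabanUV.Beta.FP.RelInvPeriodisedEffFormCoarse

/-!
# `BalabanUV.Beta.FP.RelInvPeriodisedMinOp` — road «FP» (binder row D1), ROUTE T row **(T-INV)**, sequel of `RelInvPeriodisedEffForm`:
# THE MIXED (FIELD × MULTIPLIER) BLOCKS OF THE INVERSE OF THE COMB-SLICED PERIODISED LEVEL-`j` SYSTEM — the `μ`-columns of the
# minimiser `minOp` and the `μ`-rows of its left companion `minOpL` — IN CLOSED FORM: `±Â` ON THE LIVE FIELD SLOTS, `0` ON THE COMB SLOTS

HONEST DEPENDENCY (page 1, mandatory): continuum YM on T⁴ ⇐ BetaPertH ∧ nine spine estimates (0/9 proved); BetaPertH ⇐ (D1) ∧ (D4) ∧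
CAP+tail; G-an2-4 gates asym, D1 and NE2/3/4.  HONEST FRAMING (cell contract, verbatim): «discharging `BetaPertH` makes Bałaban's UV
stability UNCONDITIONAL — a real constructive-QFT result; it is NOT the continuum limit and NOT the Clay problem.»  ABSOLUTE RULE (cell
charter, verbatim): «No internally-minted statement may enter as a cited fact. Every hypothesis is either kernel-proved in this package or a
verbatim quotation of a PUBLISHED theorem with page reference. The manuscript(s) under audit are NOT citable for their own disputed steps — they
are the thing under adjudication; programme-internal (2001/route/tribunal) claims are never citable.»  THIS MODULE is [folklore] bookkeeping BY
NAME over `RelInvPeriodisedSliced.torus_sliced_kkt` ∕ `torus_isUnit_det_kkt_of_slots` (p309426: the inverse of the torus sliced KKT on the LIVE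
slots is `+Â` on field rows, `−Â` on multiplier rows, `Â := perF M (coDressKBmAt (toSite r) Lc (KInvStep Lc j))`) and the comb bookkeeping of
`RelInvPeriodisedEffForm.effForm_toBlocks₁₁_eq_perF_KInvStep` (p314950).  No `Prop`, no `def`, nothing cited, 0 sorry.  «not in print; our bookkeeping».

WHY (leaf-05 g26, for the (T-INV) ∕ (T-ID) junction at ORDER 1).  The torus call's coarse first jet is the `μμ` block of the effective-form jet word
`(L·H₁ − S·B)·I − L·Bᵀ·S` (`I = minOp`, `L = minOpL`, `S = effForm` of the fine sliced system, `B = [Q₁₁; 0]`); its `μμ` block only sees the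
`μ`-COLUMNS of `I`, the `μ`-ROWS of `L` and `S₁₁` (`CoarseJetOrderOne.orderOne_word_toBlocks₁₁`).  `S₁₁` is p314950's (E); this file supplies the
other two blocks, so that the dictionary's order-1 identification `hId₁` becomes ONE explicit sandwich identity between periodised kernels.

CONTENT.
* §1 generic: `inv_kkt_apply_reindex` (all entries of the bordered inverse under a field re-indexing), **`inv_kkt_kill_row`** ∕ **`inv_kkt_kill_col`**
  (for slice rows that are COORDINATE KILLS `τ x b = [b = cb x]`, the killed field rows ∕ columns of the bordered inverse vanish off the
  corresponding slice-multiplier entry — pure block algebra from `K̃·K̃⁻¹ = 1 = K̃⁻¹·K̃`).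
* §2 slot-map form (the hypotheses of p309426's `torus_isUnit_det_kkt_of_slots` verbatim): **`torus_inv_kkt_of_slots_inl_inr`**
  (`K̃⁻¹ (inl b) (inr (inl a)) = if b ∈ range cb then 0 else Â (fν b) (fμ a)`), **`torus_inv_kkt_of_slots_inr_inl`** (`= … else −Â (fμ a) (fν b)`),
  **`torus_inv_kkt_of_slots_inl_inl`** (the fluctuation covariance `flucCov`: `K̃⁻¹ (inl b) (inl b') = if (b ∈ range cb ∨ b' ∈ range cb) then 0 else Â (fν b) (fν b')`).
* §3 (the presentation of record: `torus_minOp_inl` ∕ `torus_minOpL_inl` with an2's live indicator `axEc` as the comb mask, and the matrix forms) is in the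
  sequel `FP/RelInvPeriodisedMinOpRecord` (same unit, same day; the 400-line rule).
WHAT IT IS NOT: NOT the dictionary's `hId₁` (it makes its left side explicit, `CoarseJetOrderOne`); NOT (T-ID), NOT SDF, NOT D1, NOT BetaPertH, NOT
continuum, NOT Clay; discharges NO binder of row D1 by itself; 0 estimates.  Unit `b2b-balaban-beta-d1-formalise-leaf-05` (gen 26), 2026-08-22.
-/

noncomputable section

open scoped BigOperators Matrix

namespace Summit.QuantumFields.BalabanUV.Beta.FP.RelInvPeriodisedMinOp

open Matrix
open Literature.Probability.LatticeModels (Torus.proj)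
open Literature.MathematicalPhysics.QuantumFieldTheory.Balaban1983to89
open Literature.MathematicalPhysics.QuantumFieldTheory.Balaban1983to89.Beta
open Literature.MathematicalPhysics.QuantumFieldTheory.Balaban1983to89.Beta.Composition (kkt)
open Literature.MathematicalPhysics.QuantumFieldTheory.Balaban1983to89.Beta.CompositionSingular (effForm flucCov minOp minOpL)
open B6Lemma24Torus (pbox)
open AffineAveraging (Site box toSite)
open OneStepResolventKernel (Fib)
open OneStepKernelFamily (KInvStep)
open Summit.QuantumFields.BalabanUV.Beta.AxialDressingRooted (coDressKBmAt axEc axEc_inl_inl axEc_inr_inr IsCombBondAt)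
open Summit.QuantumFields.BalabanUV.Beta.BorderedHessian (bhKStepAt)
open Summit.QuantumFields.BalabanUV.Beta.SaddleInverse (regroup)
open Summit.QuantumFields.BalabanUV.Beta.FP.KernelPeriodisationFib (Idx perF)
open Summit.QuantumFields.BalabanUV.Beta.FP.TorusCombForest (baseOf axisOf)
open Summit.QuantumFields.BalabanUV.Beta.FP.TorusCombRows (Res combBondT combRowsT combBondT_eq baseOf_mem_pbox)
open Summit.QuantumFields.BalabanUV.Beta.FP.TorusCombSlots (CombSlot combSlotOf childOf combSlotOf_childOf combSlotOf_val combBondT_injective)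
open Summit.QuantumFields.BalabanUV.Beta.FP.RelInvPeriodisedSliced (torus_sliced_kkt torus_isUnit_det_kkt_of_slots kkt_submatrix_equiv)

/-! ## §1 Generic: all entries of the bordered inverse under a field re-indexing; killed coordinates -/

section Generic

variable {𝕜 : Type*} [Field 𝕜]
variable {ν ν' μ ρ : Type*} [Fintype ν] [Fintype ν'] [Fintype μ] [Fintype ρ] [DecidableEq ν] [DecidableEq ν'] [DecidableEq μ] [DecidableEq ρ]

omit [Fintype μ] [DecidableEq μ] in
/-- [folklore] **RE-INDEXING THE FIELDS ALONG `e` RE-INDEXES EVERY ENTRY OF THE BORDERED INVERSE**: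
`(kkt H Q)⁻¹ (map e id p) (map e id q) = (kkt (H∘(e,e)) (Q∘(id,e)))⁻¹ p q`. -/
theorem inv_kkt_apply_reindex {κ : Type*} [Fintype κ] [DecidableEq κ] (H : Matrix ν ν 𝕜) (Q : Matrix κ ν 𝕜) (e : ν' ≃ ν) (p q : ν' ⊕ κ) :
    (kkt H Q)⁻¹ (Sum.map e id p) (Sum.map e id q) = (kkt (H.submatrix e e) (Q.submatrix id e))⁻¹ p q := by
  have hc : ∀ z : ν' ⊕ κ, (Sum.map e id z : ν ⊕ κ) = (Equiv.sumCongr e (Equiv.refl κ)) z := by rintro (i | x) <;> rfl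
  have hm : (Sum.map e (Equiv.refl κ) : ν' ⊕ κ → ν ⊕ κ) = (Equiv.sumCongr e (Equiv.refl κ)) := rfl
  rw [hc p, hc q, show Q.submatrix id e = Q.submatrix (Equiv.refl κ) e from rfl, kkt_submatrix_equiv, hm, Matrix.inv_submatrix_equiv]
  rfl

/-- [folklore] **A KILLED FIELD ROW OF THE BORDERED INVERSE VANISHES** off its own slice-multiplier entry: if the slice rows are coordinate
kills, `τ x b = [b = cb x]`, then `(kkt H [Q;τ])⁻¹ (inl (cb x)) q = 0` for every `q ≠ inr (inr x)` — the row `inr (inr x)` of `K̃·K̃⁻¹ = 1`. -/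
theorem inv_kkt_kill_row (H : Matrix ν ν 𝕜) (Q : Matrix μ ν 𝕜) (cb : ρ → ν)
    (h : IsUnit (kkt H (fromRows Q (Matrix.of fun (x : ρ) (b : ν) => if b = cb x then (1 : 𝕜) else 0))).det)
    (x : ρ) (q : ν ⊕ (μ ⊕ ρ)) (hq : q ≠ Sum.inr (Sum.inr x)) :
    (kkt H (fromRows Q (Matrix.of fun (x : ρ) (b : ν) => if b = cb x then (1 : 𝕜) else 0)))⁻¹ (Sum.inl (cb x)) q = 0 := by
  set K := kkt H (fromRows Q (Matrix.of fun (x : ρ) (b : ν) => if b = cb x then (1 : 𝕜) else 0)) with hK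
  have h1 : (K * K⁻¹) (Sum.inr (Sum.inr x)) q = 0 := by
    rw [Matrix.mul_nonsing_inv _ h, Matrix.one_apply_ne (Ne.symm hq)]
  rw [Matrix.mul_apply, Fintype.sum_sum_type] at h1
  have hrow_inr : ∀ z : μ ⊕ ρ, K (Sum.inr (Sum.inr x)) (Sum.inr z) = 0 := fun z => by
    rw [hK, kkt]; rfl
  have hrow_inl : ∀ b : ν, K (Sum.inr (Sum.inr x)) (Sum.inl b) = if b = cb x then 1 else 0 := fun b => by
    rw [hK, kkt]; rfl
  simp only [hrow_inr, zero_mul, Finset.sum_const_zero, add_zero, hrow_inl, ite_mul, one_mul, zero_mul,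
    Finset.sum_ite_eq', Finset.mem_univ, if_true] at h1
  exact h1

/-- [folklore] **A KILLED FIELD COLUMN OF THE BORDERED INVERSE VANISHES** off its own slice-multiplier entry:
`(kkt H [Q;τ])⁻¹ p (inl (cb x)) = 0` for every `p ≠ inr (inr x)` — the column `inr (inr x)` of `K̃⁻¹·K̃ = 1`. -/
theorem inv_kkt_kill_col (H : Matrix ν ν 𝕜) (Q : Matrix μ ν 𝕜) (cb : ρ → ν)
    (h : IsUnit (kkt H (fromRows Q (Matrix.of fun (x : ρ) (b : ν) => if b = cb x then (1 : 𝕜) else 0))).det)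
    (p : ν ⊕ (μ ⊕ ρ)) (x : ρ) (hp : p ≠ Sum.inr (Sum.inr x)) :
    (kkt H (fromRows Q (Matrix.of fun (x : ρ) (b : ν) => if b = cb x then (1 : 𝕜) else 0)))⁻¹ p (Sum.inl (cb x)) = 0 := by
  set K := kkt H (fromRows Q (Matrix.of fun (x : ρ) (b : ν) => if b = cb x then (1 : 𝕜) else 0)) with hK
  have h1 : (K⁻¹ * K) p (Sum.inr (Sum.inr x)) = 0 := by
    rw [Matrix.nonsing_inv_mul _ h, Matrix.one_apply_ne hp]
  rw [Matrix.mul_apply, Fintype.sum_sum_type] at h1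
  have hcol_inr : ∀ z : μ ⊕ ρ, K (Sum.inr z) (Sum.inr (Sum.inr x)) = 0 := fun z => by
    rw [hK, kkt]; rfl
  have hcol_inl : ∀ b : ν, K (Sum.inl b) (Sum.inr (Sum.inr x)) = if b = cb x then 1 else 0 := fun b => by
    rw [hK, kkt]; rfl
  simp only [hcol_inr, mul_zero, Finset.sum_const_zero, add_zero, hcol_inl, mul_ite, mul_one, mul_zero,
    Finset.sum_ite_eq', Finset.mem_univ, if_true] at h1
  exact h1

/-- [folklore] The `μ`-column entries of the minimiser of a sliced system are bordered-inverse entries: `minOp H [Q;τ] b (inl a) = (kkt H [Q;τ])⁻¹ (inl b) (inr (inl a))`. -/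
theorem minOp_fromRows_apply_inl (H : Matrix ν ν 𝕜) (Q : Matrix μ ν 𝕜) (τ : Matrix ρ ν 𝕜) (b : ν) (a : μ) :
    minOp H (fromRows Q τ) b (Sum.inl a) = (kkt H (fromRows Q τ))⁻¹ (Sum.inl b) (Sum.inr (Sum.inl a)) := rfl

/-- [folklore] The entries of the fluctuation covariance of a sliced system: `flucCov H [Q;τ] b b' = (kkt H [Q;τ])⁻¹ (inl b) (inl b')`. -/
theorem flucCov_fromRows_apply (H : Matrix ν ν 𝕜) (Q : Matrix μ ν 𝕜) (τ : Matrix ρ ν 𝕜) (b b' : ν) :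
    flucCov H (fromRows Q τ) b b' = (kkt H (fromRows Q τ))⁻¹ (Sum.inl b) (Sum.inl b') := rfl

/-- [folklore] The `μ`-row entries of the left companion: `minOpL H [Q;τ] (inl a) b = (kkt H [Q;τ])⁻¹ (inr (inl a)) (inl b)`. -/
theorem minOpL_fromRows_apply_inl (H : Matrix ν ν 𝕜) (Q : Matrix μ ν 𝕜) (τ : Matrix ρ ν 𝕜) (a : μ) (b : ν) :
    minOpL H (fromRows Q τ) (Sum.inl a) b = (kkt H (fromRows Q τ))⁻¹ (Sum.inr (Sum.inl a)) (Sum.inl b) := rfl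

end Generic

/-! ## §2 Slot-map form: the mixed live entries of the inverse of the torus sliced KKT -/

section Slots

variable {d : ℕ} {Lc : ℕ} [NeZero Lc] {r : Fin (d + 1) → ℕ} (M : Fin (d + 1) → ℕ) [∀ μ, NeZero (M μ)]

open Classical in
/-- **[folklore] THE FIELD × MULTIPLIER ENTRIES OF THE INVERSE OF THE TORUS SLICED KKT, SLOT-MAP FORM** (hypotheses of
`RelInvPeriodisedSliced.torus_isUnit_det_kkt_of_slots` verbatim: fine bonds by `fν`, coarse multipliers by `fμ`, the comb by `cb : ρ₁ → ν`, `hlive` the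
`axEc`-live reading, `τ₁ x b := [b = cb x]`): for a field slot `b` and a multiplier `a`,
`(kkt (K̂∘(fν,fν)) [K̂∘(fμ,fν); τ₁])⁻¹ (inl b) (inr (inl a)) = if b ∈ range cb then 0 else Â (fν b) (fμ a)`,
`Â := perF M (coDressKBmAt (toSite r) Lc (KInvStep Lc j))` — `torus_sliced_kkt`'s live entries on field rows (`+Â`), §1's kill on comb rows. -/
theorem torus_inv_kkt_of_slots_inl_inr (hr : r ∈ box (d + 1) Lc) (hM : ∀ i, Lc ∣ M i) (j : ℕ)
    {ν μ ρ₁ : Type*} [Fintype ν] [Fintype μ] [Fintype ρ₁] [DecidableEq ν] [DecidableEq μ] [DecidableEq ρ₁]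
    (fν : ν → Idx M (Fib d)) (fμ : μ → Idx M (Fib d)) (hfν : Function.Injective fν) (hfμ : Function.Injective fμ)
    (hν : ∀ b : ν, ∃ α : Fin (d + 1), (fν b).2 = Sum.inl α) (hμ : ∀ a : μ, ∃ m : Fin (d + 1), (fμ a).2 = Sum.inr m)
    (cb : ρ₁ → ν) (hcb : Function.Injective cb)
    (hlive : ∀ p : Idx M (Fib d),
      axEc (toSite r) Lc p.1 p.1 p.2 p.2 = 1 ↔ (∃ b, b ∉ Set.range cb ∧ fν b = p) ∨ p ∈ Set.range fμ) (b : ν) (a : μ) :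
    (kkt ((perF M (bhKStepAt d (toSite r) Lc j)).submatrix fν fν)
      (fromRows ((perF M (bhKStepAt d (toSite r) Lc j)).submatrix fμ fν)
        (Matrix.of fun (x : ρ₁) (b : ν) => if b = cb x then (1 : ℝ) else 0)))⁻¹ (Sum.inl b) (Sum.inr (Sum.inl a))
      = if b ∈ Set.range cb then 0 else perF M (coDressKBmAt (toSite r) Lc (KInvStep (d := d) Lc j)) (fν b) (fμ a) := by
  set Mh := perF M (bhKStepAt d (toSite r) Lc j) with hMh
  by_cases hbc : b ∈ Set.range cb
  · -- a comb slot: the killed field row vanishes (§1)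
    obtain ⟨x, rfl⟩ := hbc
    rw [if_pos ⟨x, rfl⟩]
    exact inv_kkt_kill_row _ _ cb (torus_isUnit_det_kkt_of_slots M hr hM j fν fμ hfν hfμ hν hμ cb hcb hlive) x _ (by simp)
  · rw [if_neg hbc]
    -- live presentation `f := fν off the comb ⊕ fμ`, dead presentation `g := fν ∘ cb` (as in p314950)
    let f : {b : ν // b ∉ Set.range cb} ⊕ μ → Idx M (Fib d) := Sum.elim (fun b => fν b) fμ
    let g : ρ₁ → Idx M (Fib d) := fun x => fν (cb x)
    have hf : Function.Injective f := by
      rintro (b₁ | a₁) (b' | a₁') h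
      · exact congrArg Sum.inl (Subtype.ext (hfν h))
      · obtain ⟨α, hα⟩ := hν b₁; obtain ⟨m, hm⟩ := hμ a₁'
        have e : (fν b₁).2 = (fμ a₁').2 := congrArg Prod.snd h; rw [hα, hm] at e; exact absurd e Sum.inl_ne_inr
      · obtain ⟨α, hα⟩ := hν b'; obtain ⟨m, hm⟩ := hμ a₁
        have e : (fμ a₁).2 = (fν b').2 := congrArg Prod.snd h; rw [hα, hm] at e; exact absurd e Sum.inr_ne_inl
      · exact congrArg Sum.inr (hfμ h)
    have hlive' : ∀ p : Idx M (Fib d), axEc (toSite r) Lc p.1 p.1 p.2 p.2 = 1 ↔ p ∈ Set.range f := by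
      intro p
      rw [hlive p]
      constructor
      · rintro (⟨b₁, hb, rfl⟩ | ⟨a₁, rfl⟩)
        exacts [⟨Sum.inl ⟨b₁, hb⟩, rfl⟩, ⟨Sum.inr a₁, rfl⟩]
      · rintro ⟨b₁ | a₁, rfl⟩
        exacts [Or.inl ⟨b₁, b₁.2, rfl⟩, Or.inr ⟨a₁, rfl⟩]
    obtain ⟨-, hI⟩ := torus_sliced_kkt M hr hM j f hf hlive' (fun b => hν b) hμ g
    let eν : {b : ν // b ∉ Set.range cb} ⊕ ρ₁ ≃ ν :=
      ((Equiv.sumComm _ _).trans (Equiv.sumCongr (Equiv.ofInjective cb hcb) (Equiv.refl _))).trans (Equiv.sumCompl fun b => b ∈ Set.range cb)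
    have heν_inl : ∀ b : {b : ν // b ∉ Set.range cb}, eν (Sum.inl b) = b := fun b => rfl
    have heν_inr : ∀ x : ρ₁, eν (Sum.inr x) = cb x := fun x => rfl
    have hsys : kkt ((Mh.submatrix fν fν).submatrix eν eν)
          ((fromRows (Mh.submatrix fμ fν) (Matrix.of fun (x : ρ₁) (b : ν) => if b = cb x then (1 : ℝ) else 0)).submatrix id eν)
        = kkt (fromBlocks (Mh.submatrix (f ∘ Sum.inl) (f ∘ Sum.inl)) (Mh.submatrix (f ∘ Sum.inl) g) (Mh.submatrix g (f ∘ Sum.inl))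
              (Mh.submatrix g g))
            (fromRows (fromCols (Mh.submatrix (f ∘ Sum.inr) (f ∘ Sum.inl)) (Mh.submatrix (f ∘ Sum.inr) g))
              (fromCols (0 : Matrix ρ₁ {b : ν // b ∉ Set.range cb} ℝ) (1 : Matrix ρ₁ ρ₁ ℝ))) := by
      congr 1
      · ext (b₁ | x) (b' | x') <;> rfl
      · ext (a₁ | x) (b' | x') <;> try rfl
        · simp only [submatrix_apply, id, fromRows_apply_inr, fromCols_apply_inl, of_apply, heν_inl, Matrix.zero_apply]
          exact if_neg fun h : (b' : ν) = cb x => b'.2 ⟨x, h.symm⟩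
        · simp only [submatrix_apply, id, fromRows_apply_inr, fromCols_apply_inr, of_apply, heν_inr]
          by_cases h : x = x'
          · subst h; rw [if_pos rfl, Matrix.one_apply_eq]
          · rw [if_neg fun e => h (hcb e).symm, Matrix.one_apply_ne h]
    -- the live field slot `b` is `eν (inl ⟨b, hbc⟩)`; its `kBig` index is `regroup (inl (inl ⟨b, hbc⟩)) = inl (inl ⟨b, hbc⟩)` by `rfl`
    have hb : (Sum.inl b : ν ⊕ (μ ⊕ ρ₁)) = Sum.map eν id (Sum.inl (Sum.inl ⟨b, hbc⟩)) := rfl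
    have ha : (Sum.inr (Sum.inl a) : ν ⊕ (μ ⊕ ρ₁)) = Sum.map eν id (Sum.inr (Sum.inl a)) := rfl
    rw [hb, ha, inv_kkt_apply_reindex, hsys]
    have h := hI (Sum.inl ⟨b, hbc⟩) (Sum.inr a)
    simp only [Sum.elim_inl, one_mul] at h
    exact h

open Classical in
/-- **[folklore] THE MULTIPLIER × FIELD ENTRIES** (same hypotheses):
`(kkt (K̂∘(fν,fν)) [K̂∘(fμ,fν); τ₁])⁻¹ (inr (inl a)) (inl b) = if b ∈ range cb then 0 else −Â (fμ a) (fν b)` — `torus_sliced_kkt`'s live entries on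
multiplier rows (`−Â`), §1's kill on comb columns. -/
theorem torus_inv_kkt_of_slots_inr_inl (hr : r ∈ box (d + 1) Lc) (hM : ∀ i, Lc ∣ M i) (j : ℕ)
    {ν μ ρ₁ : Type*} [Fintype ν] [Fintype μ] [Fintype ρ₁] [DecidableEq ν] [DecidableEq μ] [DecidableEq ρ₁]
    (fν : ν → Idx M (Fib d)) (fμ : μ → Idx M (Fib d)) (hfν : Function.Injective fν) (hfμ : Function.Injective fμ)
    (hν : ∀ b : ν, ∃ α : Fin (d + 1), (fν b).2 = Sum.inl α) (hμ : ∀ a : μ, ∃ m : Fin (d + 1), (fμ a).2 = Sum.inr m)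
    (cb : ρ₁ → ν) (hcb : Function.Injective cb)
    (hlive : ∀ p : Idx M (Fib d),
      axEc (toSite r) Lc p.1 p.1 p.2 p.2 = 1 ↔ (∃ b, b ∉ Set.range cb ∧ fν b = p) ∨ p ∈ Set.range fμ) (a : μ) (b : ν) :
    (kkt ((perF M (bhKStepAt d (toSite r) Lc j)).submatrix fν fν)
      (fromRows ((perF M (bhKStepAt d (toSite r) Lc j)).submatrix fμ fν)
        (Matrix.of fun (x : ρ₁) (b : ν) => if b = cb x then (1 : ℝ) else 0)))⁻¹ (Sum.inr (Sum.inl a)) (Sum.inl b)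
      = if b ∈ Set.range cb then 0 else -(perF M (coDressKBmAt (toSite r) Lc (KInvStep (d := d) Lc j)) (fμ a) (fν b)) := by
  set Mh := perF M (bhKStepAt d (toSite r) Lc j) with hMh
  by_cases hbc : b ∈ Set.range cb
  · obtain ⟨x, rfl⟩ := hbc
    rw [if_pos ⟨x, rfl⟩]
    exact inv_kkt_kill_col _ _ cb (torus_isUnit_det_kkt_of_slots M hr hM j fν fμ hfν hfμ hν hμ cb hcb hlive) _ x (by simp)
  · rw [if_neg hbc]
    let f : {b : ν // b ∉ Set.range cb} ⊕ μ → Idx M (Fib d) := Sum.elim (fun b => fν b) fμ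
    let g : ρ₁ → Idx M (Fib d) := fun x => fν (cb x)
    have hf : Function.Injective f := by
      rintro (b₁ | a₁) (b' | a₁') h
      · exact congrArg Sum.inl (Subtype.ext (hfν h))
      · obtain ⟨α, hα⟩ := hν b₁; obtain ⟨m, hm⟩ := hμ a₁'
        have e : (fν b₁).2 = (fμ a₁').2 := congrArg Prod.snd h; rw [hα, hm] at e; exact absurd e Sum.inl_ne_inr
      · obtain ⟨α, hα⟩ := hν b'; obtain ⟨m, hm⟩ := hμ a₁
        have e : (fμ a₁).2 = (fν b').2 := congrArg Prod.snd h; rw [hα, hm] at e; exact absurd e Sum.inr_ne_inl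
      · exact congrArg Sum.inr (hfμ h)
    have hlive' : ∀ p : Idx M (Fib d), axEc (toSite r) Lc p.1 p.1 p.2 p.2 = 1 ↔ p ∈ Set.range f := by
      intro p
      rw [hlive p]
      constructor
      · rintro (⟨b₁, hb, rfl⟩ | ⟨a₁, rfl⟩)
        exacts [⟨Sum.inl ⟨b₁, hb⟩, rfl⟩, ⟨Sum.inr a₁, rfl⟩]
      · rintro ⟨b₁ | a₁, rfl⟩
        exacts [Or.inl ⟨b₁, b₁.2, rfl⟩, Or.inr ⟨a₁, rfl⟩]
    obtain ⟨-, hI⟩ := torus_sliced_kkt M hr hM j f hf hlive' (fun b => hν b) hμ g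
    let eν : {b : ν // b ∉ Set.range cb} ⊕ ρ₁ ≃ ν :=
      ((Equiv.sumComm _ _).trans (Equiv.sumCongr (Equiv.ofInjective cb hcb) (Equiv.refl _))).trans (Equiv.sumCompl fun b => b ∈ Set.range cb)
    have heν_inl : ∀ b : {b : ν // b ∉ Set.range cb}, eν (Sum.inl b) = b := fun b => rfl
    have heν_inr : ∀ x : ρ₁, eν (Sum.inr x) = cb x := fun x => rfl
    have hsys : kkt ((Mh.submatrix fν fν).submatrix eν eν)
          ((fromRows (Mh.submatrix fμ fν) (Matrix.of fun (x : ρ₁) (b : ν) => if b = cb x then (1 : ℝ) else 0)).submatrix id eν)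
        = kkt (fromBlocks (Mh.submatrix (f ∘ Sum.inl) (f ∘ Sum.inl)) (Mh.submatrix (f ∘ Sum.inl) g) (Mh.submatrix g (f ∘ Sum.inl))
              (Mh.submatrix g g))
            (fromRows (fromCols (Mh.submatrix (f ∘ Sum.inr) (f ∘ Sum.inl)) (Mh.submatrix (f ∘ Sum.inr) g))
              (fromCols (0 : Matrix ρ₁ {b : ν // b ∉ Set.range cb} ℝ) (1 : Matrix ρ₁ ρ₁ ℝ))) := by
      congr 1
      · ext (b₁ | x) (b' | x') <;> rfl
      · ext (a₁ | x) (b' | x') <;> try rfl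
        · simp only [submatrix_apply, id, fromRows_apply_inr, fromCols_apply_inl, of_apply, heν_inl, Matrix.zero_apply]
          exact if_neg fun h : (b' : ν) = cb x => b'.2 ⟨x, h.symm⟩
        · simp only [submatrix_apply, id, fromRows_apply_inr, fromCols_apply_inr, of_apply, heν_inr]
          by_cases h : x = x'
          · subst h; rw [if_pos rfl, Matrix.one_apply_eq]
          · rw [if_neg fun e => h (hcb e).symm, Matrix.one_apply_ne h]
    have hb : (Sum.inl b : ν ⊕ (μ ⊕ ρ₁)) = Sum.map eν id (Sum.inl (Sum.inl ⟨b, hbc⟩)) := rfl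
    have ha : (Sum.inr (Sum.inl a) : ν ⊕ (μ ⊕ ρ₁)) = Sum.map eν id (Sum.inr (Sum.inl a)) := rfl
    rw [hb, ha, inv_kkt_apply_reindex, hsys]
    have h := hI (Sum.inr a) (Sum.inl ⟨b, hbc⟩)
    simp only [Sum.elim_inr, neg_mul, one_mul] at h
    exact h

open Classical in
/-- **[folklore] THE FIELD × FIELD ENTRIES** (same hypotheses) — the fluctuation covariance `flucCov` in slot-map form:
`(kkt (K̂∘(fν,fν)) [K̂∘(fμ,fν); τ₁])⁻¹ (inl b) (inl b') = if (b ∈ range cb ∨ b' ∈ range cb) then 0 else Â (fν b) (fν b')` — `torus_sliced_kkt`'s live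
entries on field rows (`+Â`), §1's kills on comb rows AND comb columns. -/
theorem torus_inv_kkt_of_slots_inl_inl (hr : r ∈ box (d + 1) Lc) (hM : ∀ i, Lc ∣ M i) (j : ℕ)
    {ν μ ρ₁ : Type*} [Fintype ν] [Fintype μ] [Fintype ρ₁] [DecidableEq ν] [DecidableEq μ] [DecidableEq ρ₁]
    (fν : ν → Idx M (Fib d)) (fμ : μ → Idx M (Fib d)) (hfν : Function.Injective fν) (hfμ : Function.Injective fμ)
    (hν : ∀ b : ν, ∃ α : Fin (d + 1), (fν b).2 = Sum.inl α) (hμ : ∀ a : μ, ∃ m : Fin (d + 1), (fμ a).2 = Sum.inr m)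
    (cb : ρ₁ → ν) (hcb : Function.Injective cb)
    (hlive : ∀ p : Idx M (Fib d),
      axEc (toSite r) Lc p.1 p.1 p.2 p.2 = 1 ↔ (∃ b, b ∉ Set.range cb ∧ fν b = p) ∨ p ∈ Set.range fμ) (b b' : ν) :
    (kkt ((perF M (bhKStepAt d (toSite r) Lc j)).submatrix fν fν)
      (fromRows ((perF M (bhKStepAt d (toSite r) Lc j)).submatrix fμ fν)
        (Matrix.of fun (x : ρ₁) (b : ν) => if b = cb x then (1 : ℝ) else 0)))⁻¹ (Sum.inl b) (Sum.inl b')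
      = if (b ∈ Set.range cb ∨ b' ∈ Set.range cb) then 0
        else perF M (coDressKBmAt (toSite r) Lc (KInvStep (d := d) Lc j)) (fν b) (fν b') := by
  set Mh := perF M (bhKStepAt d (toSite r) Lc j) with hMh
  by_cases hbc : b ∈ Set.range cb
  · obtain ⟨x, rfl⟩ := hbc
    rw [if_pos (Or.inl ⟨x, rfl⟩)]
    exact inv_kkt_kill_row _ _ cb (torus_isUnit_det_kkt_of_slots M hr hM j fν fμ hfν hfμ hν hμ cb hcb hlive) x _ (by simp)
  by_cases hbc' : b' ∈ Set.range cb
  · obtain ⟨x, rfl⟩ := hbc'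
    rw [if_pos (Or.inr ⟨x, rfl⟩)]
    exact inv_kkt_kill_col _ _ cb (torus_isUnit_det_kkt_of_slots M hr hM j fν fμ hfν hfμ hν hμ cb hcb hlive) _ x (by simp)
  rw [if_neg (not_or.2 ⟨hbc, hbc'⟩)]
  let f : {b : ν // b ∉ Set.range cb} ⊕ μ → Idx M (Fib d) := Sum.elim (fun b => fν b) fμ
  let g : ρ₁ → Idx M (Fib d) := fun x => fν (cb x)
  have hf : Function.Injective f := by
    rintro (b₁ | a₁) (b₂ | a₁') h
    · exact congrArg Sum.inl (Subtype.ext (hfν h))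
    · obtain ⟨α, hα⟩ := hν b₁; obtain ⟨m, hm⟩ := hμ a₁'
      have e : (fν b₁).2 = (fμ a₁').2 := congrArg Prod.snd h; rw [hα, hm] at e; exact absurd e Sum.inl_ne_inr
    · obtain ⟨α, hα⟩ := hν b₂; obtain ⟨m, hm⟩ := hμ a₁
      have e : (fμ a₁).2 = (fν b₂).2 := congrArg Prod.snd h; rw [hα, hm] at e; exact absurd e Sum.inr_ne_inl
    · exact congrArg Sum.inr (hfμ h)
  have hlive' : ∀ p : Idx M (Fib d), axEc (toSite r) Lc p.1 p.1 p.2 p.2 = 1 ↔ p ∈ Set.range f := by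
    intro p
    rw [hlive p]
    constructor
    · rintro (⟨b₁, hb, rfl⟩ | ⟨a₁, rfl⟩)
      exacts [⟨Sum.inl ⟨b₁, hb⟩, rfl⟩, ⟨Sum.inr a₁, rfl⟩]
    · rintro ⟨b₁ | a₁, rfl⟩
      exacts [Or.inl ⟨b₁, b₁.2, rfl⟩, Or.inr ⟨a₁, rfl⟩]
  obtain ⟨-, hI⟩ := torus_sliced_kkt M hr hM j f hf hlive' (fun b => hν b) hμ g
  let eν : {b : ν // b ∉ Set.range cb} ⊕ ρ₁ ≃ ν :=
    ((Equiv.sumComm _ _).trans (Equiv.sumCongr (Equiv.ofInjective cb hcb) (Equiv.refl _))).trans (Equiv.sumCompl fun b => b ∈ Set.range cb)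
  have heν_inl : ∀ b : {b : ν // b ∉ Set.range cb}, eν (Sum.inl b) = b := fun b => rfl
  have heν_inr : ∀ x : ρ₁, eν (Sum.inr x) = cb x := fun x => rfl
  have hsys : kkt ((Mh.submatrix fν fν).submatrix eν eν)
        ((fromRows (Mh.submatrix fμ fν) (Matrix.of fun (x : ρ₁) (b : ν) => if b = cb x then (1 : ℝ) else 0)).submatrix id eν)
      = kkt (fromBlocks (Mh.submatrix (f ∘ Sum.inl) (f ∘ Sum.inl)) (Mh.submatrix (f ∘ Sum.inl) g) (Mh.submatrix g (f ∘ Sum.inl))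
            (Mh.submatrix g g))
          (fromRows (fromCols (Mh.submatrix (f ∘ Sum.inr) (f ∘ Sum.inl)) (Mh.submatrix (f ∘ Sum.inr) g))
            (fromCols (0 : Matrix ρ₁ {b : ν // b ∉ Set.range cb} ℝ) (1 : Matrix ρ₁ ρ₁ ℝ))) := by
    congr 1
    · ext (b₁ | x) (b₂ | x') <;> rfl
    · ext (a₁ | x) (b₂ | x') <;> try rfl
      · simp only [submatrix_apply, id, fromRows_apply_inr, fromCols_apply_inl, of_apply, heν_inl, Matrix.zero_apply]
        exact if_neg fun h : (b₂ : ν) = cb x => b₂.2 ⟨x, h.symm⟩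
      · simp only [submatrix_apply, id, fromRows_apply_inr, fromCols_apply_inr, of_apply, heν_inr]
        by_cases h : x = x'
        · subst h; rw [if_pos rfl, Matrix.one_apply_eq]
        · rw [if_neg fun e => h (hcb e).symm, Matrix.one_apply_ne h]
  have hb : (Sum.inl b : ν ⊕ (μ ⊕ ρ₁)) = Sum.map eν id (Sum.inl (Sum.inl ⟨b, hbc⟩)) := rfl
  have hb' : (Sum.inl b' : ν ⊕ (μ ⊕ ρ₁)) = Sum.map eν id (Sum.inl (Sum.inl ⟨b', hbc'⟩)) := rfl
  rw [hb, hb', inv_kkt_apply_reindex, hsys]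
  have h := hI (Sum.inl ⟨b, hbc⟩) (Sum.inl ⟨b', hbc'⟩)
  simp only [Sum.elim_inl, one_mul] at h
  exact h

end Slots

end Summit.QuantumFields.BalabanUV.Beta.FP.RelInvPeriodisedMinOp

end
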